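/-
Copyright (c) 2026 the pub-hodgecm-mathlib formalisation cell (harness21).  Prover seat hodgecm-mathlib-LH4-p07 (g12): Track B «K2-LIT» valve hand,
hLiu418 = stmt-HodgeConjecture-24832; LEAD F0P6-plan (g15) RULING M-160f + BATCH #227 «(σ-A) mini-road, brick [A3]: the two stage integrals at `s₀ = ½`»;
(σ-A) road desk K2Liu-p25 (g3), block-D desk K2Liu-p12 (g6), second reader F0P2-p11 (g3).
-/
import Summits.HodgeConjecture.HodgeConjecture.Theorems.K2LiuRankOneStagePlaceLetterValues   -- ★ p863595 (F0P2-p11): `chainValues_of_placeLetter{,_pair}` — the `cN N₁ N₂` currency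
import Literature.NumberTheory.Weil1965.LocalQuadraticFibreDensity                          -- ★ Weil 1965 Prop. 6 (finite place): `tendsto_average_fibre`, `integrable_integral_mul_psiSqPi`
import Literature.NumberTheory.Weil1965.LocalQuadraticGaussTransformGeneralForm             -- ★ `exists_linearEquiv_eq_sum_sq`, `integral_mul_addChar_eq_of_eq_sum_sq`
import Literature.NumberTheory.Weil1965.LocalQuadraticGaussTransformMatrixForm              -- ★ `separatingLeft_associated_toQuadraticForm'`, `integral_mul_comp_eq_of_eq_sum_sq`
import HarnessLib

/-!
# Crux `HLiu418`, road `K2_Liu`, #42S BLOCK D row D-2, (σ-A) mini-road brick [A3]: THE TWO STAGE INTEGRALS OF THE RANK-ONE CHAIN AT `s₀ = ½`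
# — the `L`-normalisations of (d′)(e′) cancel against (f′)'s prefactor, and the `∫_y` of a Siegel-unipotent multiplier word is WEIL'S FIBRE DENSITY OF THE
# QUADRIC CONE AT ITS VERTEX (Karel's regularised cone integral = the limit of ball averages)

Cell `hodgecm-mathlib`, crux item hLiu418 = `stmt-HodgeConjecture-24832`; squad K2 ∕ K2Liu (L1); prover LH4-p07 (g12) (LEAD F0P6-plan (g15) BATCH #227 [A3]).
THEOREMS ONLY (no `def`, no `instance`, no `notation`, no named-fact hypothesis, no `sorry`, default heartbeats); lane `--supports stmt-HodgeConjecture-24832 --as helper`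
(count-neutral helper; closes no socket).

THE SETTING (★ p863595 `K2LiuRankOneStagePlaceLetterValues.chainValues_of_placeLetter`, F0P2-p11 (g3)).  At a finite place `v` of `F` inert∕ramified in `E` the
(K1a-3) place letter `Gn′` of the corner-twisted big cell is served by the stage families `(cN, N₁, N₂)`:
(d′) `N₁ s g = L_F(2s+1)⁻¹ · ∫_y f s (φ(w₂)·φ(u_{2e₂}(ι y δ))·g) dμF` on `−½ < re s`; (e′) `N₂ s g = L_{E∕F}(2s)⁻¹ · ∫_ζ N₁ s (φ(w₁)·φ(u⁻(ζ e_w))·g) dμw` on `0 < re s`;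
(f′) `Gn′ s₀ h = cN · L_F(2s₀+1) · L_{E∕F}(2s₀) · ∫_{x ∈ 𝔭^{−k}} conj ψ(σx) · N₂ s₀ (φ(w₂)·φ(u_{2e₂}(ι x δ))·h) dμF` for `k ≥ k₀(h)`, `0 < re s₀`.
The #42S block-D seam (★ p863939 `K2LiuIncoherentRankOneBadPlaceLineModel`, letters `Λ hΛ Φ hWfun`; ★ `K2LiuIncoherentRankOneBadPlaceSeam.hV_of_stageB_seam`, letter
`hseam`) needs the value `N₂ (½) (φ(w₂)·φ(u(xδ))·h)` — pointwise in the Whittaker ball variable `x` — as an explicit functional of the Siegel–Weil datum.  The (σ-A)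
mini-road (K2Liu-p25 (g3) census 2026-09-05T01:17:33Z; LEAD RULING M-160f) splits that into [A1] the Schrödinger-model words of the four corner elements, [A2] the
partial Fourier transform ∕ pure-tensor splitting, [A3] (this file) the two stage integrals at `s₀ = ½`, [A4] the pure-tensor reduction to the line word.

THIS FILE ([A3] FILE 1; [A1]-byte-free throughout — the hypothesis-first junctions with [A1]∕[A2]'s words and the bundled corollary over ★ `chainValues_of_placeLetter`'s
own binders are the sequel `K2LiuRankOneStageIntegralsAtHalfWords.lean`):
* §1 `p`-FIELD ANALYSIS — **`tendsto_ballAverage_nullCone`** (+ the Gram-matrix form `…_dotProduct_mulVec`): for a non-degenerate quadratic form `Q` on `K^ι`,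
  `3 ≤ card ι`, `Ψ ∈ 𝒮(K^ι)`, `ψ` of conductor exponent `d`, the Gauss transform `β ↦ G_Ψ(β) = ∫ Ψ(x) ψ(β·Q(x)) dμ^ι` is INTEGRABLE and
  `selfDualConst μ d · μ(𝔭^k)⁻¹ · ∫ Ψ(x)·1_{𝔭^k}(Q x) dμ^ι ⟶ ∫_β G_Ψ(β) dμ` (`k → ∞`): «the integral over the Siegel-unipotent parameter of the multiplier word
  `ψ(β·Q)` is the FIBRE DENSITY OF THE QUADRIC CONE `{Q = 0}` AT ITS VERTEX», i.e. Karel's regularised cone integral `lim_k q^{…}·∫_{Q(x) ∈ 𝔭^k} Ψ` — Weil 1965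
  Prop. 6 at `b₀ = 0` (★ `tendsto_average_fibre`, diagonal case) transported to a general form by ★ `exists_linearEquiv_eq_sum_sq` (the module `‖det e‖⁻¹` appears on
  both sides and cancels).  This is the `∫_y`-collapse of [A3]: after [A1]∕[A2], `f ½ (φ(w₂)·φ(u(yδ))·g) = γ(g)·G_{Ψ_g}(−y∕2)`-shape with `Ψ_g` the `e₂`-block slice of
  `ω(g)Φ` and `Q` the Gram form [A1] delivers (`r = 6 ≥ 3`).
* §2 STAGE BOOKKEEPING ON `0 < re s₀` AND AT `s₀ = ½` in F0P2-p11's currency — **`stageB_eq_double_integral_of_pos_re`** ∕ **`stageB_half_eq_double_integral`**: from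
  the letters (d′)(e′) alone, `N₂ s₀ g = L_F(2s₀+1)⁻¹ · L_{E∕F}(2s₀)⁻¹ · ∫_ζ ∫_y f s₀ (φ(w₂)·φ(u(yδ))·(φ(w₁)·φ(u⁻(ζe_w))·g)) dμF dμw` for EVERY `g` (at `½`: `L_F(2)⁻¹·L_{E∕F}(1)⁻¹`);
  **`placeLetter_eq_corner_integral_of_pos_re`** ∕ **`placeLetter_half_eq_corner_integral`**: with (f′) as well, ONE `k₀(h)` with
  `Gn′ s₀ h = cN · ∫_{x ∈ 𝔭^{−k}} conj ψ(σx) · ∫_ζ ∫_y f s₀ (φ(w₂)·φ(u(yδ))·(φ(w₁)·φ(u⁻(ζe_w))·(φ(w₂)·φ(u(xδ))·h))) dμF dμw dμF` for all `s₀` with `0 < re s₀` and `k ≥ k₀` —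
  the `L`-factors CANCEL (non-zero on the half-planes for unitary `χ_v`: ★ `lF_ne_zero`, ★ `K2LiuA7NormaliserAlgebra.lEN_ne_zero`).
NOT here (sequel `…AtHalfWords`): the junction `hword : ∀ y, f ½ (φ(w₂)·φ(u(yδ))·g) = γ · ∫ x, Ψ x · ψ(y·Q(x)) dμ^ι ⟹ L_F(2)·N₁ (1∕2) g = γ · ∫_β G_Ψ(β)` (+ its §1 ball
limit) hypothesis-first on [A1] (K2Liu-p09) ∕ [A2] (K2Liu-p12, K2Liu-p23), and the bundled `s₀ = ½` corollary of ★ `chainValues_of_placeLetter`; NOT anywhere here: the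
Schrödinger-model words themselves ([A1]), the partial Fourier ∕ tensor splitting ([A2]), the line word and `hWfun` ([A4], K2Liu-p25); the `ζ`-stage closed form waits on
[A1]'s coordinates (a translation-type `leviOpPi` word).
HONEST LABEL.  `HC_CM` is proved only modulo the 7 printed citations (2 remaining named inputs: hLiu418 = `stmt-HodgeConjecture-24832`,
h413 = `stmt-HodgeConjecture-24833`) until rung 0 closes; this file is a count-neutral helper and closes no socket.

## References
* [Weil1965] A. Weil, *Sur la formule de Siegel dans la théorie des groupes classiques*, Acta Math. 113 (1965), Chap. I n° 2 Prop. 2; Chap. III n° 34–36 Prop. 6 (p. 54).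
* [KudlaRallis1994] S. Kudla, S. Rallis, Ann. of Math. 140 (1994), §2 (singular coefficients of the Siegel big cell), §5 (5.3)–(5.6) (the regularised orbital integral).
* [Casselman1980] W. Casselman, Compositio Math. 40 (1980), §3 Thm. 3.1.   * [KudlaSweet1997] S. Kudla, W. J. Sweet, Israel J. Math. 98 (1997), §1.
* [Tate1950] J. Tate, *Fourier analysis in number fields and Hecke's zeta-functions* (1950), §2.2 Thm 2.2.2, §2.5.
-/

set_option autoImplicit false
set_option linter.dupNamespace false -- the mandated namespace repeats `HodgeConjecture.HodgeConjecture`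

noncomputable section

/-! ## §1 `p`-field analysis: the integral over the unipotent parameter of a multiplier word is the fibre density of the null cone at its vertex -/

namespace Summit.HodgeConjecture.HodgeConjecture.Cruxes.HLiu418.K2LiuRankOneStageIntegralsAtHalf

section NullCone

open MeasureTheory Filter Topology Set Matrix
open scoped NNReal Pointwise
open Literature.NumberTheory.GaloisRepresentations.IsNonarchimedeanLocalField
open Literature.NumberTheory.Automorphic Literature.NumberTheory.Weil1964 Literature.NumberTheory.Weil1965

variable {K : Type*} [Field K] [ValuativeRel K] [TopologicalSpace K] [IsNonarchimedeanLocalField K]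
variable {ι : Type*} [Fintype ι] [MeasurableSpace K] [BorelSpace K] (μ : Measure K) [μ.IsAddHaarMeasure] {ψ : AddChar K Circle}

omit [ValuativeRel K] [TopologicalSpace K] [IsNonarchimedeanLocalField K] [BorelSpace K] [μ.IsAddHaarMeasure] in
/-- `𝓕G(−0) = ∫ G` (the Fourier transform at the origin is the total integral). [cite: Tate1950, §2.2] -/
theorem fourierSB_neg_zero (G : K → ℂ) : fourierSB ψ μ G (-0) = ∫ β, G β ∂μ := by
  rw [neg_zero, fourierSB_apply]
  refine integral_congr_ae (Eventually.of_forall fun β => ?_)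
  simp only [mul_zero, AddChar.map_zero_eq_one, Circle.coe_one, one_mul]

/-- **DIAGONAL CASE** of the null-cone ball limit: for `f = Σ cᵢ xᵢ²`, `cᵢ ≠ 0`, `3 ≤ card ι`, `Ψ ∈ 𝒮(K^ι)`:
`selfDualConst μ d · μ(𝔭^k)⁻¹ · ∫ Ψ·1_{𝔭^k}(f) ⟶ ∫_β G_Ψ(β) dμ` with `G_Ψ(β) = ∫ Ψ(x) ψ(β f(x)) dμ^ι` integrable — Weil's Prop. 6 at the vertex `b₀ = 0`.
[cite: Weil1965, Chap. III n° 36 Prop. 6, p. 54] -/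
theorem tendsto_ballAverage_nullCone_sum_sq {d : ℤ} (hd : ψ.HasConductorExp d) {v₂ : ℤ}
    (h2 : normAbs K (2 : K) = (residueFieldCard K : ℝ≥0)⁻¹ ^ v₂) {c : ι → K} (hc : ∀ i, c i ≠ 0)
    {Ψ : (ι → K) → ℂ} (hΨ : Ψ ∈ SchwartzBruhat (ι → K)) (hr : 3 ≤ Fintype.card ι) :
    Integrable (fun β : K => ∫ x, Ψ x * psiSqPi ψ (fun i => β * c i) x ∂(Measure.pi fun _ : ι => μ)) μ ∧
    Tendsto (fun k : ℕ => (selfDualConst μ d : ℂ) * (μ.real (primePowBall K k) : ℂ)⁻¹ *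
        ∫ x, Ψ x * (primePowBall K (k : ℤ)).indicator (fun _ => (1 : ℂ)) (∑ i, c i * x i ^ 2) ∂(Measure.pi fun _ : ι => μ)) atTop
      (𝓝 (∫ β, ∫ x, Ψ x * psiSqPi ψ (fun i => β * c i) x ∂(Measure.pi fun _ : ι => μ) ∂μ)) := by
  refine ⟨integrable_integral_mul_psiSqPi μ hd h2 hc hΨ hr, ?_⟩
  have h := tendsto_average_fibre μ hd h2 hc hΨ hr (0 : K)
  rw [fourierSB_neg_zero] at h
  refine h.congr fun k => ?_
  rw [show ((0 : K) +ᵥ primePowBall K (k : ℤ) : Set K) = primePowBall K (k : ℤ) from zero_vadd K _]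

/-- **THE NULL-CONE BALL LIMIT FOR A GENERAL NON-DEGENERATE QUADRATIC FORM** (`3 ≤ card ι`, char `≠ 2`): for `Ψ ∈ 𝒮(K^ι)` the Gauss transform
`β ↦ G_Ψ(β) = ∫ Ψ(x) ψ(β·Q(x)) dμ^ι` is integrable and `selfDualConst μ d · μ(𝔭^k)⁻¹ · ∫ Ψ(x)·1_{𝔭^k}(Q x) dμ^ι(x) ⟶ ∫_β G_Ψ(β) dμ` as `k → ∞` — «the
integral over the Siegel-unipotent parameter of the multiplier word `ψ(β Q)` is the fibre density of the quadric cone `{Q = 0}` at its vertex» (Karel's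
regularised cone integral).  Diagonalise (★ `exists_linearEquiv_eq_sum_sq`), change variables on both sides (module `‖det e‖⁻¹`), ★ diagonal case.
[cite: Weil1965, Chap. III n° 36 Prop. 6, p. 54] [cite: KudlaRallis1994, §5 (5.3)–(5.6)] -/
theorem tendsto_ballAverage_nullCone [Invertible (2 : K)] {d : ℤ} (hd : ψ.HasConductorExp d) {v₂ : ℤ}
    (h2 : normAbs K (2 : K) = (residueFieldCard K : ℝ≥0)⁻¹ ^ v₂) (Q : QuadraticForm K (ι → K))
    (hQ : (QuadraticMap.associated (R := K) Q).SeparatingLeft) {Ψ : (ι → K) → ℂ} (hΨ : Ψ ∈ SchwartzBruhat (ι → K))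
    (hr : 3 ≤ Fintype.card ι) :
    Integrable (fun β : K => ∫ x, Ψ x * ((ψ (β * Q x) : Circle) : ℂ) ∂(Measure.pi fun _ : ι => μ)) μ ∧
    Tendsto (fun k : ℕ => (selfDualConst μ d : ℂ) * (μ.real (primePowBall K k) : ℂ)⁻¹ *
        ∫ x, Ψ x * (primePowBall K (k : ℤ)).indicator (fun _ => (1 : ℂ)) (Q x) ∂(Measure.pi fun _ : ι => μ)) atTop
      (𝓝 (∫ β, ∫ x, Ψ x * ((ψ (β * Q x) : Circle) : ℂ) ∂(Measure.pi fun _ : ι => μ) ∂μ)) := by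
  obtain ⟨e, c, hc, hQe⟩ := exists_linearEquiv_eq_sum_sq Q hQ
  have hΨ' : (Ψ ∘ e.symm) ∈ SchwartzBruhat (ι → K) := comp_linearEquiv_mem_schwartzBruhat hΨ e.symm
  obtain ⟨hint, hlim⟩ := tendsto_ballAverage_nullCone_sum_sq μ hd h2 hc hΨ' hr
  set D : ℝ := ((normAbs K (LinearMap.det (e : (ι → K) →ₗ[K] (ι → K)))⁻¹ : ℝ≥0) : ℝ) with hDdef
  -- the Gauss transform of `Q` is `D •` the diagonal one of `Ψ ∘ e⁻¹`
  have hG : (fun β : K => ∫ x, Ψ x * ((ψ (β * Q x) : Circle) : ℂ) ∂(Measure.pi fun _ : ι => μ)) =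
      fun β => D • ∫ y, (Ψ ∘ e.symm) y * psiSqPi ψ (fun i => β * c i) y ∂(Measure.pi fun _ : ι => μ) := by
    funext β
    exact integral_mul_addChar_eq_of_eq_sum_sq μ Ψ e c hQe β
  -- the ball integrals of `Q` are `D •` the diagonal ones
  have hB : ∀ k : ℕ, ∫ x, Ψ x * (primePowBall K (k : ℤ)).indicator (fun _ => (1 : ℂ)) (Q x) ∂(Measure.pi fun _ : ι => μ) =
      D • ∫ y, (Ψ ∘ e.symm) y * (primePowBall K (k : ℤ)).indicator (fun _ => (1 : ℂ)) (∑ i, c i * y i ^ 2) ∂(Measure.pi fun _ : ι => μ) :=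
    fun k => integral_mul_comp_eq_of_eq_sum_sq μ Ψ ((primePowBall K (k : ℤ)).indicator fun _ => (1 : ℂ)) e c hQe
  refine ⟨?_, ?_⟩
  · rw [hG]
    exact hint.smul D
  · rw [hG, integral_smul]
    have h := hlim.const_smul D
    refine h.congr fun k => ?_
    rw [hB k, Complex.real_smul, Complex.real_smul]
    ring

omit [ValuativeRel K] [TopologicalSpace K] [IsNonarchimedeanLocalField K] [MeasurableSpace K] in
/-- the quadratic form of a matrix: `toQuadraticForm' S x = x ⬝ᵥ S *ᵥ x` (a copy of the private lemma of ★ `LocalQuadraticGaussTransformMatrixForm`). [folklore] -/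
theorem toQuadraticForm'_apply_eq [DecidableEq ι] (S : Matrix ι ι K) (x : ι → K) : Matrix.toQuadraticForm' S x = x ⬝ᵥ S *ᵥ x := by
  rw [Matrix.toQuadraticForm', LinearMap.BilinMap.toQuadraticMap_apply, Matrix.toLinearMap₂'_apply']

/-- **THE NULL-CONE BALL LIMIT, GRAM-MATRIX FORM** `Q(x) = xᵀ S x` (`S` symmetric, `det S ≠ 0`, `3 ≤ card ι`): the Gauss transform
`β ↦ ∫ Ψ(x) ψ(β·xᵀSx) dμ^ι` is integrable and `selfDualConst μ d · μ(𝔭^k)⁻¹ · ∫ Ψ(x)·1_{𝔭^k}(xᵀSx) dμ^ι ⟶ ∫_β ∫ Ψ(x) ψ(β·xᵀSx) dμ^ι dμ`.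
[cite: Weil1965, Chap. III n° 36 Prop. 6, p. 54] [cite: KudlaRallis1994, §5 (5.3)–(5.6)] -/
theorem tendsto_ballAverage_nullCone_dotProduct_mulVec [DecidableEq ι] [Invertible (2 : K)] {d : ℤ} (hd : ψ.HasConductorExp d) {v₂ : ℤ}
    (h2 : normAbs K (2 : K) = (residueFieldCard K : ℝ≥0)⁻¹ ^ v₂) {S : Matrix ι ι K} (hS : S.IsSymm) (hSd : S.det ≠ 0)
    {Ψ : (ι → K) → ℂ} (hΨ : Ψ ∈ SchwartzBruhat (ι → K)) (hr : 3 ≤ Fintype.card ι) :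
    Integrable (fun β : K => ∫ x, Ψ x * ((ψ (β * (x ⬝ᵥ S *ᵥ x)) : Circle) : ℂ) ∂(Measure.pi fun _ : ι => μ)) μ ∧
    Tendsto (fun k : ℕ => (selfDualConst μ d : ℂ) * (μ.real (primePowBall K k) : ℂ)⁻¹ *
        ∫ x, Ψ x * (primePowBall K (k : ℤ)).indicator (fun _ => (1 : ℂ)) (x ⬝ᵥ S *ᵥ x) ∂(Measure.pi fun _ : ι => μ)) atTop
      (𝓝 (∫ β, ∫ x, Ψ x * ((ψ (β * (x ⬝ᵥ S *ᵥ x)) : Circle) : ℂ) ∂(Measure.pi fun _ : ι => μ) ∂μ)) := by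
  simpa only [toQuadraticForm'_apply_eq] using
    tendsto_ballAverage_nullCone μ hd h2 (Matrix.toQuadraticForm' S) (separatingLeft_associated_toQuadraticForm' hS hSd) hΨ hr

end NullCone

end Summit.HodgeConjecture.HodgeConjecture.Cruxes.HLiu418.K2LiuRankOneStageIntegralsAtHalf

/-! ## §2 Stage bookkeeping at `s₀ = ½` in the `cN N₁ N₂` currency of ★ `chainValues_of_placeLetter` -/

namespace Summit.HodgeConjecture.HodgeConjecture.Cruxes.HLiu418.K2LiuRankOneStageIntegralsAtHalf

section StageHalf

open scoped Classical NNReal ENNReal ComplexConjugate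
open NumberField IsDedekindDomain Matrix MeasureTheory Topology
open Literature.NumberTheory.GaloisRepresentations.IsNonarchimedeanLocalField
open Literature.NumberTheory.Automorphic Literature.NumberTheory.Automorphic.UnitaryGroup
open Literature.NumberTheory.GelbartRogawski1991.AdaptedBlocks
open Literature.NumberTheory.GelbartRogawski1991.UnitaryDualPair.LocalSplitting
open Literature.NumberTheory.K2Lit.LocalSiegelDoubled
open Summit.HodgeConjecture.HodgeConjecture.Cruxes.HLiu418.K2LiuQRationalDefs
open Summit.HodgeConjecture.HodgeConjecture.Cruxes.HLiu418.K2LiuQRationalLFactor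
open Summit.HodgeConjecture.HodgeConjecture.Cruxes.HLiu418.K2LiuLocalLFactorDefs
open Summit.HodgeConjecture.HodgeConjecture.Cruxes.HLiu418.K2LiuLocalSiegelIwasawaFrame
open Summit.HodgeConjecture.HodgeConjecture.Cruxes.HLiu418.K2LiuLocalSiegelIwasawa
open Summit.HodgeConjecture.HodgeConjecture.Cruxes.HLiu418.K2LiuDoubledUTwoTwoBorelFrame
open Summit.HodgeConjecture.HodgeConjecture.Cruxes.HLiu418.K2LiuDoubledUTwoTwoWeylCocycle
open Summit.HodgeConjecture.HodgeConjecture.Cruxes.HLiu418.K2LiuDoubledUTwoTwoLevi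
open Summit.HodgeConjecture.HodgeConjecture.Cruxes.HLiu418.K2LiuDoubledUTwoTwoFrameTransport
open Summit.HodgeConjecture.HodgeConjecture.Cruxes.HLiu418.K2LiuDoubledUTwoTwoUnipotentCoordinates
open Summit.HodgeConjecture.HodgeConjecture.Cruxes.HLiu418.K2LiuDoubledUTwoTwoUnipotentHaar
open Summit.HodgeConjecture.HodgeConjecture.Cruxes.HLiu418.K2LiuDoubledUTwoTwoLeviTransport
open Summit.HodgeConjecture.HodgeConjecture.Cruxes.HLiu418.K2LiuUnipDeltaRankOneCoordinates
open Summit.HodgeConjecture.HodgeConjecture.Cruxes.HLiu418.K2LiuSiegelCocycleLetters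
open Summit.HodgeConjecture.HodgeConjecture.Cruxes.HLiu418.K2LiuSiegelCocycleStageLetters
open Summit.HodgeConjecture.HodgeConjecture.Cruxes.HLiu418.K2LiuSiegelCocycleStageShort
open Summit.HodgeConjecture.HodgeConjecture.Cruxes.HLiu418.K2LiuSiegelCocycleChainShort
open Summit.HodgeConjecture.HodgeConjecture.Cruxes.HLiu418.K2LiuSiegelCocycleChainLong
open Summit.HodgeConjecture.HodgeConjecture.Cruxes.HLiu418.K2LiuIteratedRankOneCocycle
open Summit.HodgeConjecture.HodgeConjecture.Cruxes.HLiu418.K2LiuSiegelIntertwiningCocycle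
open Summit.HodgeConjecture.HodgeConjecture.Cruxes.HLiu418.K2LiuRankOneStage
open Summit.HodgeConjecture.HodgeConjecture.Cruxes.HLiu418.K2LiuRankOneStageTwisted
open Summit.HodgeConjecture.HodgeConjecture.Cruxes.HLiu418.K2LiuFlatSiegelFamilies
open Summit.HodgeConjecture.HodgeConjecture.Cruxes.HLiu418.K2LiuLocalRingPlaceDecomposition
open Summit.HodgeConjecture.HodgeConjecture.Cruxes.HLiu418.K2LiuRankOneStagePlaceLetterValues

variable (F : Type) [Field F] [NumberField F] (E : Type) [Field E] [NumberField E] [Algebra F E]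
  [Algebra.IsQuadraticExtension F E] (c : E ≃ₐ[F] E)
  {δ : E} (hcδ : c δ = -δ) (hδ : δ ≠ 0) {d : F} (hd : δ * δ = algebraMap F E d) (v : HeightOneSpectrum (𝓞 F))
  {T₂ : Matrix (Fin 2) (Fin 2) F} (hT₂ : T₂.IsSymm) {J₂D : Matrix (Fin (2 + 2)) (Fin (2 + 2)) E} (hJ₂D : J₂D = (gramD F 2 T₂).map (algebraMap F E))
  (D Dinv : Matrix (Fin 2) (Fin 2) F) (hDD : D * Dinv = 1) (hDD' : Dinv * D = 1) (Q : GL (Fin (2 + 2)) F)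
  (hQm : (Q : Matrix (Fin (2 + 2)) (Fin (2 + 2)) F) = Matrix.reindex (e₂ 2) (e₂ 2) (Matrix.fromBlocks 1 D 1 (-D)))
  (hQ : (Q : Matrix (Fin (2 + 2)) (Fin (2 + 2)) F)ᵀ * gramD F 2 T₂ * (Q : Matrix (Fin (2 + 2)) (Fin (2 + 2)) F) = (StdForm.antidiagonal (2 + 2)).over F)

/-- `0 < re ½`, `−½ < re ½`, `2·½ + 1 = 2`, `2·½ = 1` (the arithmetic of the point `s₀ = ½`). [folklore] -/
theorem half_re_facts : (0 : ℝ) < ((1 / 2 : ℂ)).re ∧ (-1 : ℝ) / 2 < ((1 / 2 : ℂ)).re ∧ (2 : ℂ) * (1 / 2) + 1 = 2 ∧ (2 : ℂ) * (1 / 2) = 1 := by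
  have h : ((1 / 2 : ℂ)).re = 1 / 2 := by norm_num [Complex.div_re]
  refine ⟨by rw [h]; norm_num, by rw [h]; norm_num, by norm_num, by norm_num⟩

/-- on `0 < re s₀`: `−½ < re s₀`, `0 < re (2s₀ + 1)`, `0 < re (2s₀)` (the thresholds of (d′), `L_F(2s₀+1)`, `L_{E∕F}(2s₀)`). [folklore] -/
theorem re_facts_of_pos_re {s₀ : ℂ} (hs₀ : 0 < s₀.re) : (-1 : ℝ) / 2 < s₀.re ∧ (0 : ℝ) < (2 * s₀ + 1).re ∧ (0 : ℝ) < (2 * s₀).re := by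
  have h2 : (2 * s₀).re = 2 * s₀.re := by simp [Complex.mul_re]
  refine ⟨by linarith, ?_, by rw [h2]; linarith⟩
  rw [Complex.add_re, h2, Complex.one_re]
  linarith

/-- **STAGE B ON `0 < re s₀` IS AN HONEST DOUBLE INTEGRAL OF THE SECTION `f s₀`** — from the letters (d′)(e′) of ★ `chainValues_of_placeLetter` alone (their types VERBATIM,
`N₁ N₂` abstract): for EVERY `g`, `N₂ s₀ g = L_F(2s₀+1,χ_F)_v⁻¹ · L_{E∕F}(2s₀,χ_F∘N)_v⁻¹ · ∫_ζ ∫_y f s₀ (φ(w₂)·φ(u_{2e₂}(ι y δ))·(φ(w₁)·φ(u⁻(ζ e_w))·g)) dμF dμw` (stage A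
converges on `−½ < re`, stage B on `0 < re`; the stage-A normalisation is pulled out of the `ζ`-integral by linearity of the Bochner integral — no integrability needed).
[cite: Casselman1980, §3 Thm. 3.1] [cite: KudlaRallis1994, §2] [cite: KudlaSweet1997, §1] -/
theorem stageB_eq_double_integral_of_pos_re
    (χv : ∀ w : PlacesOver E v, (w.1.adicCompletion E)ˣ →* ℂˣ)
    (f : ℂ → UnitaryGroup.localPi E c (2 + 2) J₂D v → ℂ) (w : PlacesOver E v)
    [MeasurableSpace (v.adicCompletion F)] (μF : Measure (v.adicCompletion F))
    [MeasurableSpace (w.1.adicCompletion E)] (μw : Measure (w.1.adicCompletion E))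
    (N₁ N₂ : ℂ → UnitaryGroup.localPi E c (2 + 2) J₂D v → ℂ)
    (hA : ∀ s : ℂ, (-1 : ℝ) / 2 < s.re → ∀ g : UnitaryGroup.localPi E c (2 + 2) J₂D v,
        Integrable (fun y => f s (FrameTransport.frameConj F E c v (2 + 2) hJ₂D (antidiagonal_over_eq_map F E 2) Q hQ (toLocalFour F E c v (weylTwo (UnitaryGroup.LocalRing E v) (UnitaryGroup.conjLocal E c v))) * FrameTransport.frameConj F E c v (2 + 2) hJ₂D (antidiagonal_over_eq_map F E 2) Q hQ (toLocalFour F E c v (uLongTwo (UnitaryGroup.LocalRing E v) (UnitaryGroup.conjLocal E c v) (UnitaryGroup.toLocalRing E v y * algebraMap E (UnitaryGroup.LocalRing E v) δ) (conjLocal_coord F E c hcδ v y))) * g)) μF ∧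
        N₁ s g = (lF F E v χv (2 * s + 1))⁻¹ * ∫ y, f s (FrameTransport.frameConj F E c v (2 + 2) hJ₂D (antidiagonal_over_eq_map F E 2) Q hQ (toLocalFour F E c v (weylTwo (UnitaryGroup.LocalRing E v) (UnitaryGroup.conjLocal E c v))) * FrameTransport.frameConj F E c v (2 + 2) hJ₂D (antidiagonal_over_eq_map F E 2) Q hQ (toLocalFour F E c v (uLongTwo (UnitaryGroup.LocalRing E v) (UnitaryGroup.conjLocal E c v) (UnitaryGroup.toLocalRing E v y * algebraMap E (UnitaryGroup.LocalRing E v) δ) (conjLocal_coord F E c hcδ v y))) * g) ∂μF)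
    (hB : ∀ s : ℂ, 0 < s.re → ∀ g : UnitaryGroup.localPi E c (2 + 2) J₂D v,
        Integrable (fun ζ => N₁ s (FrameTransport.frameConj F E c v (2 + 2) hJ₂D (antidiagonal_over_eq_map F E 2) Q hQ (toLocalFour F E c v (weylOne (UnitaryGroup.LocalRing E v) (UnitaryGroup.conjLocal E c v))) * FrameTransport.frameConj F E c v (2 + 2) hJ₂D (antidiagonal_over_eq_map F E 2) Q hQ (toLocalFour F E c v (uMinus (UnitaryGroup.LocalRing E v) (UnitaryGroup.conjLocal E c v) (UnitaryGroup.conjLocal_conjLocal c v hcδ hδ) (Pi.single w ζ))) * g)) μw ∧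
        N₂ s g = (lEN F E c v χv (2 * s))⁻¹ * ∫ ζ, N₁ s (FrameTransport.frameConj F E c v (2 + 2) hJ₂D (antidiagonal_over_eq_map F E 2) Q hQ (toLocalFour F E c v (weylOne (UnitaryGroup.LocalRing E v) (UnitaryGroup.conjLocal E c v))) * FrameTransport.frameConj F E c v (2 + 2) hJ₂D (antidiagonal_over_eq_map F E 2) Q hQ (toLocalFour F E c v (uMinus (UnitaryGroup.LocalRing E v) (UnitaryGroup.conjLocal E c v) (UnitaryGroup.conjLocal_conjLocal c v hcδ hδ) (Pi.single w ζ))) * g) ∂μw)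
    {s₀ : ℂ} (hs₀ : 0 < s₀.re) (g : UnitaryGroup.localPi E c (2 + 2) J₂D v) :
    N₂ s₀ g = (lF F E v χv (2 * s₀ + 1))⁻¹ * (lEN F E c v χv (2 * s₀))⁻¹ *
      ∫ ζ, ∫ y, f s₀ (FrameTransport.frameConj F E c v (2 + 2) hJ₂D (antidiagonal_over_eq_map F E 2) Q hQ (toLocalFour F E c v (weylTwo (UnitaryGroup.LocalRing E v) (UnitaryGroup.conjLocal E c v))) * FrameTransport.frameConj F E c v (2 + 2) hJ₂D (antidiagonal_over_eq_map F E 2) Q hQ (toLocalFour F E c v (uLongTwo (UnitaryGroup.LocalRing E v) (UnitaryGroup.conjLocal E c v) (UnitaryGroup.toLocalRing E v y * algebraMap E (UnitaryGroup.LocalRing E v) δ) (conjLocal_coord F E c hcδ v y))) *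
        (FrameTransport.frameConj F E c v (2 + 2) hJ₂D (antidiagonal_over_eq_map F E 2) Q hQ (toLocalFour F E c v (weylOne (UnitaryGroup.LocalRing E v) (UnitaryGroup.conjLocal E c v))) * FrameTransport.frameConj F E c v (2 + 2) hJ₂D (antidiagonal_over_eq_map F E 2) Q hQ (toLocalFour F E c v (uMinus (UnitaryGroup.LocalRing E v) (UnitaryGroup.conjLocal E c v) (UnitaryGroup.conjLocal_conjLocal c v hcδ hδ) (Pi.single w ζ))) * g)) ∂μF ∂μw := by
  obtain ⟨hm, -, -⟩ := re_facts_of_pos_re hs₀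
  obtain ⟨-, hN₂⟩ := hB s₀ hs₀ g
  rw [hN₂]
  have h1 : (fun ζ => N₁ s₀ (FrameTransport.frameConj F E c v (2 + 2) hJ₂D (antidiagonal_over_eq_map F E 2) Q hQ (toLocalFour F E c v (weylOne (UnitaryGroup.LocalRing E v) (UnitaryGroup.conjLocal E c v))) * FrameTransport.frameConj F E c v (2 + 2) hJ₂D (antidiagonal_over_eq_map F E 2) Q hQ (toLocalFour F E c v (uMinus (UnitaryGroup.LocalRing E v) (UnitaryGroup.conjLocal E c v) (UnitaryGroup.conjLocal_conjLocal c v hcδ hδ) (Pi.single w ζ))) * g)) =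
      fun ζ => (lF F E v χv (2 * s₀ + 1))⁻¹ * ∫ y, f s₀ (FrameTransport.frameConj F E c v (2 + 2) hJ₂D (antidiagonal_over_eq_map F E 2) Q hQ (toLocalFour F E c v (weylTwo (UnitaryGroup.LocalRing E v) (UnitaryGroup.conjLocal E c v))) * FrameTransport.frameConj F E c v (2 + 2) hJ₂D (antidiagonal_over_eq_map F E 2) Q hQ (toLocalFour F E c v (uLongTwo (UnitaryGroup.LocalRing E v) (UnitaryGroup.conjLocal E c v) (UnitaryGroup.toLocalRing E v y * algebraMap E (UnitaryGroup.LocalRing E v) δ) (conjLocal_coord F E c hcδ v y))) *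
        (FrameTransport.frameConj F E c v (2 + 2) hJ₂D (antidiagonal_over_eq_map F E 2) Q hQ (toLocalFour F E c v (weylOne (UnitaryGroup.LocalRing E v) (UnitaryGroup.conjLocal E c v))) * FrameTransport.frameConj F E c v (2 + 2) hJ₂D (antidiagonal_over_eq_map F E 2) Q hQ (toLocalFour F E c v (uMinus (UnitaryGroup.LocalRing E v) (UnitaryGroup.conjLocal E c v) (UnitaryGroup.conjLocal_conjLocal c v hcδ hδ) (Pi.single w ζ))) * g)) ∂μF :=
    funext fun ζ => (hA s₀ hm _).2
  rw [h1, integral_const_mul]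
  ring

/-- **STAGE B AT `s₀ = ½`**: `N₂ (1∕2) g = L_F(2,χ_F)_v⁻¹ · L_{E∕F}(1,χ_F∘N)_v⁻¹ · ∫_ζ ∫_y f (1∕2) (φ(w₂)·φ(u(yδ))·(φ(w₁)·φ(u⁻(ζ e_w))·g)) dμF dμw` for EVERY `g` — in
particular the #42S seam value `N₂ (½) (φ(w₂)·φ(u(xδ))·h)` is, pointwise in the Whittaker variable `x`, an honest `(ζ, y)`-integral of `f ½` along
`φ(w₂)·φ(u(yδ))·φ(w₁)·φ(u⁻(ζ))·φ(w₂)·φ(u(xδ))·h`. [cite: Casselman1980, §3 Thm. 3.1] [cite: KudlaRallis1994, §2] [cite: KudlaSweet1997, §1] -/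
theorem stageB_half_eq_double_integral
    (χv : ∀ w : PlacesOver E v, (w.1.adicCompletion E)ˣ →* ℂˣ)
    (f : ℂ → UnitaryGroup.localPi E c (2 + 2) J₂D v → ℂ) (w : PlacesOver E v)
    [MeasurableSpace (v.adicCompletion F)] (μF : Measure (v.adicCompletion F))
    [MeasurableSpace (w.1.adicCompletion E)] (μw : Measure (w.1.adicCompletion E))
    (N₁ N₂ : ℂ → UnitaryGroup.localPi E c (2 + 2) J₂D v → ℂ)
    (hA : ∀ s : ℂ, (-1 : ℝ) / 2 < s.re → ∀ g : UnitaryGroup.localPi E c (2 + 2) J₂D v,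
        Integrable (fun y => f s (FrameTransport.frameConj F E c v (2 + 2) hJ₂D (antidiagonal_over_eq_map F E 2) Q hQ (toLocalFour F E c v (weylTwo (UnitaryGroup.LocalRing E v) (UnitaryGroup.conjLocal E c v))) * FrameTransport.frameConj F E c v (2 + 2) hJ₂D (antidiagonal_over_eq_map F E 2) Q hQ (toLocalFour F E c v (uLongTwo (UnitaryGroup.LocalRing E v) (UnitaryGroup.conjLocal E c v) (UnitaryGroup.toLocalRing E v y * algebraMap E (UnitaryGroup.LocalRing E v) δ) (conjLocal_coord F E c hcδ v y))) * g)) μF ∧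
        N₁ s g = (lF F E v χv (2 * s + 1))⁻¹ * ∫ y, f s (FrameTransport.frameConj F E c v (2 + 2) hJ₂D (antidiagonal_over_eq_map F E 2) Q hQ (toLocalFour F E c v (weylTwo (UnitaryGroup.LocalRing E v) (UnitaryGroup.conjLocal E c v))) * FrameTransport.frameConj F E c v (2 + 2) hJ₂D (antidiagonal_over_eq_map F E 2) Q hQ (toLocalFour F E c v (uLongTwo (UnitaryGroup.LocalRing E v) (UnitaryGroup.conjLocal E c v) (UnitaryGroup.toLocalRing E v y * algebraMap E (UnitaryGroup.LocalRing E v) δ) (conjLocal_coord F E c hcδ v y))) * g) ∂μF)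
    (hB : ∀ s : ℂ, 0 < s.re → ∀ g : UnitaryGroup.localPi E c (2 + 2) J₂D v,
        Integrable (fun ζ => N₁ s (FrameTransport.frameConj F E c v (2 + 2) hJ₂D (antidiagonal_over_eq_map F E 2) Q hQ (toLocalFour F E c v (weylOne (UnitaryGroup.LocalRing E v) (UnitaryGroup.conjLocal E c v))) * FrameTransport.frameConj F E c v (2 + 2) hJ₂D (antidiagonal_over_eq_map F E 2) Q hQ (toLocalFour F E c v (uMinus (UnitaryGroup.LocalRing E v) (UnitaryGroup.conjLocal E c v) (UnitaryGroup.conjLocal_conjLocal c v hcδ hδ) (Pi.single w ζ))) * g)) μw ∧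
        N₂ s g = (lEN F E c v χv (2 * s))⁻¹ * ∫ ζ, N₁ s (FrameTransport.frameConj F E c v (2 + 2) hJ₂D (antidiagonal_over_eq_map F E 2) Q hQ (toLocalFour F E c v (weylOne (UnitaryGroup.LocalRing E v) (UnitaryGroup.conjLocal E c v))) * FrameTransport.frameConj F E c v (2 + 2) hJ₂D (antidiagonal_over_eq_map F E 2) Q hQ (toLocalFour F E c v (uMinus (UnitaryGroup.LocalRing E v) (UnitaryGroup.conjLocal E c v) (UnitaryGroup.conjLocal_conjLocal c v hcδ hδ) (Pi.single w ζ))) * g) ∂μw)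
    (g : UnitaryGroup.localPi E c (2 + 2) J₂D v) :
    N₂ (1 / 2) g = (lF F E v χv 2)⁻¹ * (lEN F E c v χv 1)⁻¹ *
      ∫ ζ, ∫ y, f (1 / 2) (FrameTransport.frameConj F E c v (2 + 2) hJ₂D (antidiagonal_over_eq_map F E 2) Q hQ (toLocalFour F E c v (weylTwo (UnitaryGroup.LocalRing E v) (UnitaryGroup.conjLocal E c v))) * FrameTransport.frameConj F E c v (2 + 2) hJ₂D (antidiagonal_over_eq_map F E 2) Q hQ (toLocalFour F E c v (uLongTwo (UnitaryGroup.LocalRing E v) (UnitaryGroup.conjLocal E c v) (UnitaryGroup.toLocalRing E v y * algebraMap E (UnitaryGroup.LocalRing E v) δ) (conjLocal_coord F E c hcδ v y))) *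
        (FrameTransport.frameConj F E c v (2 + 2) hJ₂D (antidiagonal_over_eq_map F E 2) Q hQ (toLocalFour F E c v (weylOne (UnitaryGroup.LocalRing E v) (UnitaryGroup.conjLocal E c v))) * FrameTransport.frameConj F E c v (2 + 2) hJ₂D (antidiagonal_over_eq_map F E 2) Q hQ (toLocalFour F E c v (uMinus (UnitaryGroup.LocalRing E v) (UnitaryGroup.conjLocal E c v) (UnitaryGroup.conjLocal_conjLocal c v hcδ hδ) (Pi.single w ζ))) * g)) ∂μF ∂μw := by
  obtain ⟨h0, -, e1, e2⟩ := half_re_facts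
  rw [stageB_eq_double_integral_of_pos_re F E c hcδ hδ v hJ₂D Q hQ χv f w μF μw N₁ N₂ hA hB h0 g, e1, e2]

/-- **THE PLACE LETTER ON `0 < re s₀` IS `cN` TIMES THE TRIPLE CORNER INTEGRAL OF `f s₀`** — from (d′)(e′) and the ball clause (f′) of ★ `chainValues_of_placeLetter` (types
VERBATIM, (f′) for the one `h` at hand; `k₀` uniform in `s₀`): for every `s₀` with `0 < re s₀` and every `k ≥ k₀`,
`Gn′ s₀ h = cN · ∫_{x ∈ 𝔭^{−k}} conj ψ(σx) · ∫_ζ ∫_y f s₀ (φ(w₂)·φ(u(yδ))·(φ(w₁)·φ(u⁻(ζ e_w))·(φ(w₂)·φ(u(xδ))·h))) dμF dμw dμF(x)` — the normalisations `L_F(2s₀+1)⁻¹`,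
`L_{E∕F}(2s₀)⁻¹` of (d′)(e′) CANCEL against (f′)'s prefactor (`L_F`, `L_{E∕F}` non-zero on the half-planes for unitary `χ_v`: ★ `lF_ne_zero`, ★ `lEN_ne_zero`).
[cite: Casselman1980, §3 Thm. 3.1] [cite: KudlaRallis1994, §2] [cite: KudlaSweet1997, §1] -/
theorem placeLetter_eq_corner_integral_of_pos_re
    (χv : ∀ w : PlacesOver E v, (w.1.adicCompletion E)ˣ →* ℂˣ) (hχ : ∀ (w' : PlacesOver E v) (x : (w'.1.adicCompletion E)ˣ), ‖((χv w' x : ℂˣ) : ℂ)‖ = 1)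
    (f : ℂ → UnitaryGroup.localPi E c (2 + 2) J₂D v → ℂ)
    (ψ : AddChar (v.adicCompletion F) Circle) (σ : v.adicCompletion F) (w : PlacesOver E v)
    [MeasurableSpace (v.adicCompletion F)] (μF : Measure (v.adicCompletion F))
    [MeasurableSpace (w.1.adicCompletion E)] (μw : Measure (w.1.adicCompletion E))
    (cN : ℝ≥0) (N₁ N₂ : ℂ → UnitaryGroup.localPi E c (2 + 2) J₂D v → ℂ)
    (hA : ∀ s : ℂ, (-1 : ℝ) / 2 < s.re → ∀ g : UnitaryGroup.localPi E c (2 + 2) J₂D v,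
        Integrable (fun y => f s (FrameTransport.frameConj F E c v (2 + 2) hJ₂D (antidiagonal_over_eq_map F E 2) Q hQ (toLocalFour F E c v (weylTwo (UnitaryGroup.LocalRing E v) (UnitaryGroup.conjLocal E c v))) * FrameTransport.frameConj F E c v (2 + 2) hJ₂D (antidiagonal_over_eq_map F E 2) Q hQ (toLocalFour F E c v (uLongTwo (UnitaryGroup.LocalRing E v) (UnitaryGroup.conjLocal E c v) (UnitaryGroup.toLocalRing E v y * algebraMap E (UnitaryGroup.LocalRing E v) δ) (conjLocal_coord F E c hcδ v y))) * g)) μF ∧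
        N₁ s g = (lF F E v χv (2 * s + 1))⁻¹ * ∫ y, f s (FrameTransport.frameConj F E c v (2 + 2) hJ₂D (antidiagonal_over_eq_map F E 2) Q hQ (toLocalFour F E c v (weylTwo (UnitaryGroup.LocalRing E v) (UnitaryGroup.conjLocal E c v))) * FrameTransport.frameConj F E c v (2 + 2) hJ₂D (antidiagonal_over_eq_map F E 2) Q hQ (toLocalFour F E c v (uLongTwo (UnitaryGroup.LocalRing E v) (UnitaryGroup.conjLocal E c v) (UnitaryGroup.toLocalRing E v y * algebraMap E (UnitaryGroup.LocalRing E v) δ) (conjLocal_coord F E c hcδ v y))) * g) ∂μF)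
    (hB : ∀ s : ℂ, 0 < s.re → ∀ g : UnitaryGroup.localPi E c (2 + 2) J₂D v,
        Integrable (fun ζ => N₁ s (FrameTransport.frameConj F E c v (2 + 2) hJ₂D (antidiagonal_over_eq_map F E 2) Q hQ (toLocalFour F E c v (weylOne (UnitaryGroup.LocalRing E v) (UnitaryGroup.conjLocal E c v))) * FrameTransport.frameConj F E c v (2 + 2) hJ₂D (antidiagonal_over_eq_map F E 2) Q hQ (toLocalFour F E c v (uMinus (UnitaryGroup.LocalRing E v) (UnitaryGroup.conjLocal E c v) (UnitaryGroup.conjLocal_conjLocal c v hcδ hδ) (Pi.single w ζ))) * g)) μw ∧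
        N₂ s g = (lEN F E c v χv (2 * s))⁻¹ * ∫ ζ, N₁ s (FrameTransport.frameConj F E c v (2 + 2) hJ₂D (antidiagonal_over_eq_map F E 2) Q hQ (toLocalFour F E c v (weylOne (UnitaryGroup.LocalRing E v) (UnitaryGroup.conjLocal E c v))) * FrameTransport.frameConj F E c v (2 + 2) hJ₂D (antidiagonal_over_eq_map F E 2) Q hQ (toLocalFour F E c v (uMinus (UnitaryGroup.LocalRing E v) (UnitaryGroup.conjLocal E c v) (UnitaryGroup.conjLocal_conjLocal c v hcδ hδ) (Pi.single w ζ))) * g) ∂μw)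
    (Gn' : ℂ → UnitaryGroup.localPi E c (2 + 2) J₂D v → ℂ) (h : UnitaryGroup.localPi E c (2 + 2) J₂D v)
    (hball : ∃ k₀ : ℕ, ∀ s₀ : ℂ, 0 < s₀.re → ∀ k : ℕ, k₀ ≤ k →
        Gn' s₀ h = ((cN : ℝ) : ℂ) * (lF F E v χv (2 * s₀ + 1) * lEN F E c v χv (2 * s₀) *
          ∫ x in primePowBall (v.adicCompletion F) (-(k : ℤ)), conj ((ψ (σ * x) : ℂ)) * N₂ s₀ (FrameTransport.frameConj F E c v (2 + 2) hJ₂D (antidiagonal_over_eq_map F E 2) Q hQ (toLocalFour F E c v (weylTwo (UnitaryGroup.LocalRing E v) (UnitaryGroup.conjLocal E c v))) * FrameTransport.frameConj F E c v (2 + 2) hJ₂D (antidiagonal_over_eq_map F E 2) Q hQ (toLocalFour F E c v (uLongTwo (UnitaryGroup.LocalRing E v) (UnitaryGroup.conjLocal E c v) (UnitaryGroup.toLocalRing E v x * algebraMap E (UnitaryGroup.LocalRing E v) δ) (conjLocal_coord F E c hcδ v x))) * h) ∂μF)) :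
    ∃ k₀ : ℕ, ∀ s₀ : ℂ, 0 < s₀.re → ∀ k : ℕ, k₀ ≤ k →
      Gn' s₀ h = ((cN : ℝ) : ℂ) *
        ∫ x in primePowBall (v.adicCompletion F) (-(k : ℤ)), conj ((ψ (σ * x) : ℂ)) *
          ∫ ζ, ∫ y, f s₀ (FrameTransport.frameConj F E c v (2 + 2) hJ₂D (antidiagonal_over_eq_map F E 2) Q hQ (toLocalFour F E c v (weylTwo (UnitaryGroup.LocalRing E v) (UnitaryGroup.conjLocal E c v))) * FrameTransport.frameConj F E c v (2 + 2) hJ₂D (antidiagonal_over_eq_map F E 2) Q hQ (toLocalFour F E c v (uLongTwo (UnitaryGroup.LocalRing E v) (UnitaryGroup.conjLocal E c v) (UnitaryGroup.toLocalRing E v y * algebraMap E (UnitaryGroup.LocalRing E v) δ) (conjLocal_coord F E c hcδ v y))) *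
            (FrameTransport.frameConj F E c v (2 + 2) hJ₂D (antidiagonal_over_eq_map F E 2) Q hQ (toLocalFour F E c v (weylOne (UnitaryGroup.LocalRing E v) (UnitaryGroup.conjLocal E c v))) * FrameTransport.frameConj F E c v (2 + 2) hJ₂D (antidiagonal_over_eq_map F E 2) Q hQ (toLocalFour F E c v (uMinus (UnitaryGroup.LocalRing E v) (UnitaryGroup.conjLocal E c v) (UnitaryGroup.conjLocal_conjLocal c v hcδ hδ) (Pi.single w ζ))) *
              (FrameTransport.frameConj F E c v (2 + 2) hJ₂D (antidiagonal_over_eq_map F E 2) Q hQ (toLocalFour F E c v (weylTwo (UnitaryGroup.LocalRing E v) (UnitaryGroup.conjLocal E c v))) * FrameTransport.frameConj F E c v (2 + 2) hJ₂D (antidiagonal_over_eq_map F E 2) Q hQ (toLocalFour F E c v (uLongTwo (UnitaryGroup.LocalRing E v) (UnitaryGroup.conjLocal E c v) (UnitaryGroup.toLocalRing E v x * algebraMap E (UnitaryGroup.LocalRing E v) δ) (conjLocal_coord F E c hcδ v x))) * h))) ∂μF ∂μw ∂μF := by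
  obtain ⟨k₀, hk₀⟩ := hball
  refine ⟨k₀, fun s₀ hs₀ k hk => ?_⟩
  obtain ⟨-, h₁, h₂⟩ := re_facts_of_pos_re hs₀
  rw [hk₀ s₀ hs₀ k hk]
  have hL₁ : lF F E v χv (2 * s₀ + 1) ≠ 0 := lF_ne_zero hχ h₁
  have hL₂ : lEN F E c v χv (2 * s₀) ≠ 0 := K2LiuA7NormaliserAlgebra.lEN_ne_zero c χv hχ h₂
  -- substitute the stage-B double integral pointwise in the Whittaker variable and pull the normalisations out of the ball integral
  have hpt : ∀ x : v.adicCompletion F,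
      conj ((ψ (σ * x) : ℂ)) * N₂ s₀ (FrameTransport.frameConj F E c v (2 + 2) hJ₂D (antidiagonal_over_eq_map F E 2) Q hQ (toLocalFour F E c v (weylTwo (UnitaryGroup.LocalRing E v) (UnitaryGroup.conjLocal E c v))) * FrameTransport.frameConj F E c v (2 + 2) hJ₂D (antidiagonal_over_eq_map F E 2) Q hQ (toLocalFour F E c v (uLongTwo (UnitaryGroup.LocalRing E v) (UnitaryGroup.conjLocal E c v) (UnitaryGroup.toLocalRing E v x * algebraMap E (UnitaryGroup.LocalRing E v) δ) (conjLocal_coord F E c hcδ v x))) * h) =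
      ((lF F E v χv (2 * s₀ + 1))⁻¹ * (lEN F E c v χv (2 * s₀))⁻¹) * (conj ((ψ (σ * x) : ℂ)) *
        ∫ ζ, ∫ y, f s₀ (FrameTransport.frameConj F E c v (2 + 2) hJ₂D (antidiagonal_over_eq_map F E 2) Q hQ (toLocalFour F E c v (weylTwo (UnitaryGroup.LocalRing E v) (UnitaryGroup.conjLocal E c v))) * FrameTransport.frameConj F E c v (2 + 2) hJ₂D (antidiagonal_over_eq_map F E 2) Q hQ (toLocalFour F E c v (uLongTwo (UnitaryGroup.LocalRing E v) (UnitaryGroup.conjLocal E c v) (UnitaryGroup.toLocalRing E v y * algebraMap E (UnitaryGroup.LocalRing E v) δ) (conjLocal_coord F E c hcδ v y))) *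
        (FrameTransport.frameConj F E c v (2 + 2) hJ₂D (antidiagonal_over_eq_map F E 2) Q hQ (toLocalFour F E c v (weylOne (UnitaryGroup.LocalRing E v) (UnitaryGroup.conjLocal E c v))) * FrameTransport.frameConj F E c v (2 + 2) hJ₂D (antidiagonal_over_eq_map F E 2) Q hQ (toLocalFour F E c v (uMinus (UnitaryGroup.LocalRing E v) (UnitaryGroup.conjLocal E c v) (UnitaryGroup.conjLocal_conjLocal c v hcδ hδ) (Pi.single w ζ))) * (FrameTransport.frameConj F E c v (2 + 2) hJ₂D (antidiagonal_over_eq_map F E 2) Q hQ (toLocalFour F E c v (weylTwo (UnitaryGroup.LocalRing E v) (UnitaryGroup.conjLocal E c v))) * FrameTransport.frameConj F E c v (2 + 2) hJ₂D (antidiagonal_over_eq_map F E 2) Q hQ (toLocalFour F E c v (uLongTwo (UnitaryGroup.LocalRing E v) (UnitaryGroup.conjLocal E c v) (UnitaryGroup.toLocalRing E v x * algebraMap E (UnitaryGroup.LocalRing E v) δ) (conjLocal_coord F E c hcδ v x))) * h))) ∂μF ∂μw) := by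
    intro x
    rw [stageB_eq_double_integral_of_pos_re F E c hcδ hδ v hJ₂D Q hQ χv f w μF μw N₁ N₂ hA hB hs₀]
    ring
  simp_rw [hpt]
  rw [integral_const_mul]
  field_simp

/-- **THE PLACE LETTER AT `s₀ = ½`**: for `k ≥ k₀(h)`,
`Gn′ (1∕2) h = cN · ∫_{x ∈ 𝔭^{−k}} conj ψ(σx) · ∫_ζ ∫_y f (1∕2) (φ(w₂)·φ(u(yδ))·(φ(w₁)·φ(u⁻(ζ e_w))·(φ(w₂)·φ(u(xδ))·h))) dμF dμw dμF(x)` — at the #42S point the continued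
bad-place factor is `cN` times a ball integral of honest `(ζ, y)`-integrals of THE SECTION AT `½` (no `L`-factor left).
[cite: Casselman1980, §3 Thm. 3.1] [cite: KudlaRallis1994, §2] [cite: KudlaSweet1997, §1] -/
theorem placeLetter_half_eq_corner_integral
    (χv : ∀ w : PlacesOver E v, (w.1.adicCompletion E)ˣ →* ℂˣ) (hχ : ∀ (w' : PlacesOver E v) (x : (w'.1.adicCompletion E)ˣ), ‖((χv w' x : ℂˣ) : ℂ)‖ = 1)
    (f : ℂ → UnitaryGroup.localPi E c (2 + 2) J₂D v → ℂ)
    (ψ : AddChar (v.adicCompletion F) Circle) (σ : v.adicCompletion F) (w : PlacesOver E v)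
    [MeasurableSpace (v.adicCompletion F)] (μF : Measure (v.adicCompletion F))
    [MeasurableSpace (w.1.adicCompletion E)] (μw : Measure (w.1.adicCompletion E))
    (cN : ℝ≥0) (N₁ N₂ : ℂ → UnitaryGroup.localPi E c (2 + 2) J₂D v → ℂ)
    (hA : ∀ s : ℂ, (-1 : ℝ) / 2 < s.re → ∀ g : UnitaryGroup.localPi E c (2 + 2) J₂D v,
        Integrable (fun y => f s (FrameTransport.frameConj F E c v (2 + 2) hJ₂D (antidiagonal_over_eq_map F E 2) Q hQ (toLocalFour F E c v (weylTwo (UnitaryGroup.LocalRing E v) (UnitaryGroup.conjLocal E c v))) * FrameTransport.frameConj F E c v (2 + 2) hJ₂D (antidiagonal_over_eq_map F E 2) Q hQ (toLocalFour F E c v (uLongTwo (UnitaryGroup.LocalRing E v) (UnitaryGroup.conjLocal E c v) (UnitaryGroup.toLocalRing E v y * algebraMap E (UnitaryGroup.LocalRing E v) δ) (conjLocal_coord F E c hcδ v y))) * g)) μF ∧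
        N₁ s g = (lF F E v χv (2 * s + 1))⁻¹ * ∫ y, f s (FrameTransport.frameConj F E c v (2 + 2) hJ₂D (antidiagonal_over_eq_map F E 2) Q hQ (toLocalFour F E c v (weylTwo (UnitaryGroup.LocalRing E v) (UnitaryGroup.conjLocal E c v))) * FrameTransport.frameConj F E c v (2 + 2) hJ₂D (antidiagonal_over_eq_map F E 2) Q hQ (toLocalFour F E c v (uLongTwo (UnitaryGroup.LocalRing E v) (UnitaryGroup.conjLocal E c v) (UnitaryGroup.toLocalRing E v y * algebraMap E (UnitaryGroup.LocalRing E v) δ) (conjLocal_coord F E c hcδ v y))) * g) ∂μF)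
    (hB : ∀ s : ℂ, 0 < s.re → ∀ g : UnitaryGroup.localPi E c (2 + 2) J₂D v,
        Integrable (fun ζ => N₁ s (FrameTransport.frameConj F E c v (2 + 2) hJ₂D (antidiagonal_over_eq_map F E 2) Q hQ (toLocalFour F E c v (weylOne (UnitaryGroup.LocalRing E v) (UnitaryGroup.conjLocal E c v))) * FrameTransport.frameConj F E c v (2 + 2) hJ₂D (antidiagonal_over_eq_map F E 2) Q hQ (toLocalFour F E c v (uMinus (UnitaryGroup.LocalRing E v) (UnitaryGroup.conjLocal E c v) (UnitaryGroup.conjLocal_conjLocal c v hcδ hδ) (Pi.single w ζ))) * g)) μw ∧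
        N₂ s g = (lEN F E c v χv (2 * s))⁻¹ * ∫ ζ, N₁ s (FrameTransport.frameConj F E c v (2 + 2) hJ₂D (antidiagonal_over_eq_map F E 2) Q hQ (toLocalFour F E c v (weylOne (UnitaryGroup.LocalRing E v) (UnitaryGroup.conjLocal E c v))) * FrameTransport.frameConj F E c v (2 + 2) hJ₂D (antidiagonal_over_eq_map F E 2) Q hQ (toLocalFour F E c v (uMinus (UnitaryGroup.LocalRing E v) (UnitaryGroup.conjLocal E c v) (UnitaryGroup.conjLocal_conjLocal c v hcδ hδ) (Pi.single w ζ))) * g) ∂μw)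
    (Gn' : ℂ → UnitaryGroup.localPi E c (2 + 2) J₂D v → ℂ) (h : UnitaryGroup.localPi E c (2 + 2) J₂D v)
    (hball : ∃ k₀ : ℕ, ∀ s₀ : ℂ, 0 < s₀.re → ∀ k : ℕ, k₀ ≤ k →
        Gn' s₀ h = ((cN : ℝ) : ℂ) * (lF F E v χv (2 * s₀ + 1) * lEN F E c v χv (2 * s₀) *
          ∫ x in primePowBall (v.adicCompletion F) (-(k : ℤ)), conj ((ψ (σ * x) : ℂ)) * N₂ s₀ (FrameTransport.frameConj F E c v (2 + 2) hJ₂D (antidiagonal_over_eq_map F E 2) Q hQ (toLocalFour F E c v (weylTwo (UnitaryGroup.LocalRing E v) (UnitaryGroup.conjLocal E c v))) * FrameTransport.frameConj F E c v (2 + 2) hJ₂D (antidiagonal_over_eq_map F E 2) Q hQ (toLocalFour F E c v (uLongTwo (UnitaryGroup.LocalRing E v) (UnitaryGroup.conjLocal E c v) (UnitaryGroup.toLocalRing E v x * algebraMap E (UnitaryGroup.LocalRing E v) δ) (conjLocal_coord F E c hcδ v x))) * h) ∂μF)) :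
    ∃ k₀ : ℕ, ∀ k : ℕ, k₀ ≤ k →
      Gn' (1 / 2) h = ((cN : ℝ) : ℂ) *
        ∫ x in primePowBall (v.adicCompletion F) (-(k : ℤ)), conj ((ψ (σ * x) : ℂ)) *
          ∫ ζ, ∫ y, f (1 / 2) (FrameTransport.frameConj F E c v (2 + 2) hJ₂D (antidiagonal_over_eq_map F E 2) Q hQ (toLocalFour F E c v (weylTwo (UnitaryGroup.LocalRing E v) (UnitaryGroup.conjLocal E c v))) * FrameTransport.frameConj F E c v (2 + 2) hJ₂D (antidiagonal_over_eq_map F E 2) Q hQ (toLocalFour F E c v (uLongTwo (UnitaryGroup.LocalRing E v) (UnitaryGroup.conjLocal E c v) (UnitaryGroup.toLocalRing E v y * algebraMap E (UnitaryGroup.LocalRing E v) δ) (conjLocal_coord F E c hcδ v y))) *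
            (FrameTransport.frameConj F E c v (2 + 2) hJ₂D (antidiagonal_over_eq_map F E 2) Q hQ (toLocalFour F E c v (weylOne (UnitaryGroup.LocalRing E v) (UnitaryGroup.conjLocal E c v))) * FrameTransport.frameConj F E c v (2 + 2) hJ₂D (antidiagonal_over_eq_map F E 2) Q hQ (toLocalFour F E c v (uMinus (UnitaryGroup.LocalRing E v) (UnitaryGroup.conjLocal E c v) (UnitaryGroup.conjLocal_conjLocal c v hcδ hδ) (Pi.single w ζ))) *
              (FrameTransport.frameConj F E c v (2 + 2) hJ₂D (antidiagonal_over_eq_map F E 2) Q hQ (toLocalFour F E c v (weylTwo (UnitaryGroup.LocalRing E v) (UnitaryGroup.conjLocal E c v))) * FrameTransport.frameConj F E c v (2 + 2) hJ₂D (antidiagonal_over_eq_map F E 2) Q hQ (toLocalFour F E c v (uLongTwo (UnitaryGroup.LocalRing E v) (UnitaryGroup.conjLocal E c v) (UnitaryGroup.toLocalRing E v x * algebraMap E (UnitaryGroup.LocalRing E v) δ) (conjLocal_coord F E c hcδ v x))) * h))) ∂μF ∂μw ∂μF := by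
  obtain ⟨k₀, hk₀⟩ := placeLetter_eq_corner_integral_of_pos_re F E c hcδ hδ v hJ₂D Q hQ χv hχ f ψ σ w μF μw cN N₁ N₂ hA hB Gn' h hball
  exact ⟨k₀, fun k hk => hk₀ (1 / 2) half_re_facts.1 k hk⟩

end StageHalf

end Summit.HodgeConjecture.HodgeConjecture.Cruxes.HLiu418.K2LiuRankOneStageIntegralsAtHalf

end
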